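import Summits.BirchSwinnertonDyer.BirchSwinnertonDyer.Theorems.ClassRecordThreeRegCertKernelO2Log
import Summits.BirchSwinnertonDyer.BirchSwinnertonDyer.Theorems.ClassRecordThreeRegCertKernelO2Aux
import HarnessLib

/-!
# Route `ClassRecordThree`, crux `SchneiderAtThree` (item 19106): the Iwasawa logarithm to FOUR terms
# (cell `bsd-stepL`, seat `bsd-stepL-reg3-eng` g3; `--supports stmt-BirchSwinnertonDyer-19106`)

HONEST FRAMING: BSD is not proved by any of this; nothing here closes the crux; Schneider's conjecture (barrier
`PAdicHeightNondegeneracy`) is asserted NOWHERE. One `3`-adic digit beyond `…O3Deep` §1, for REG3CERT rows with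
`v₃(h(Q)) = 4`: §1 `L(y) = −t − t²/2 − t³/3 − t⁴/4 + O(‖t‖⁵)` (`t = 1 − y`, `‖t‖ ≤ 3⁻¹`); §2 the quartic
`T + T²/2 + T³/3 + T⁴/4` is `1`-Lipschitz on `‖T‖ ≤ 3⁻¹`; §3 for `Y = 3^{2K}·t`, `‖t − U‖ ≤ 3⁻⁵`, `U` a unit with
`‖U² − 1‖ ≤ 3⁻¹`: `‖log₃ Y − ½(V − V²/2 + V³/3 − V⁴/4)‖ ≤ 3⁻⁵`, `V = U² − 1` (Iwasawa normalisation `log₃ 3 = 0`).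
Theorems only (0 defs, 0 facts). References: [Iwasawa1972PadicL] §4.4; [SteinWuthrich2013] §4.2.
-/

open scoped Classical
open WeierstrassCurve Literature.NumberTheory.EllipticCurves
  Literature.NumberTheory.EllipticCurves.SteinWuthrich2013
  Summit.BirchSwinnertonDyer.Rank1Residual.X11b.RegMult.Rung62310y1

namespace Summit.BirchSwinnertonDyer.Rank1Residual.X11b.RegMult.KernelCert

/-! ### §0 Plumbing -/

/-- Ultrametric inequality for differences. [folklore] -/
private theorem norm_sub_le_max₁₁ (a b : ℚ_[3]) : ‖a - b‖ ≤ max ‖a‖ ‖b‖ := by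
  rw [sub_eq_add_neg, ← norm_neg b]; exact IsUltrametricDist.norm_add_le_max a (-b)

/-- `‖(2 : ℚ₃)⁻¹‖ = 1`. [folklore] -/
private theorem norm_inv_two₁₁ : ‖(2 : ℚ_[3])⁻¹‖ = 1 := by
  rw [norm_inv, show (2 : ℚ_[3]) = ((2 : ℤ) : ℚ_[3]) by norm_cast, norm_intCast_eq_one_of_not_dvd (by decide),
    inv_one]

/-- `‖(3 : ℚ₃)⁻¹‖ = 3`. [folklore] -/
private theorem norm_inv_three₁₁ : ‖(3 : ℚ_[3])⁻¹‖ = 3 := by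
  rw [norm_inv, show (3 : ℚ_[3]) = ((3 : ℕ) : ℚ_[3]) by norm_cast, Padic.norm_p]; norm_num

/-- `‖(4 : ℚ₃)⁻¹‖ = 1`. [folklore] -/
private theorem norm_inv_four₁₁ : ‖(4 : ℚ_[3])⁻¹‖ = 1 := by
  rw [norm_inv, show (4 : ℚ_[3]) = ((4 : ℤ) : ℚ_[3]) by norm_cast, norm_intCast_eq_one_of_not_dvd (by decide),
    inv_one]

/-- `n + 7 ≤ 3^{n+2}`. [folklore] -/
private theorem add_seven_le_three_pow' (n : ℕ) : n + 7 ≤ 3 ^ (n + 2) := by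
  induction n with
  | zero => norm_num
  | succ k ih =>
    have h : 3 ^ (k + 1 + 2) = 3 * 3 ^ (k + 2) := by ring
    omega

/-- `‖1/(n+5)‖₃ ≤ 3ⁿ` (`5` is a unit, `‖1/6‖ = 3`, `‖1/m‖ ≤ m ≤ 3^{m−5}` for `m ≥ 7`). [folklore] -/
private theorem norm_inv_natCast_add_five_le' (n : ℕ) : ‖(((n + 5 : ℕ) : ℚ_[3]))⁻¹‖ ≤ (3 : ℝ) ^ n := by
  rcases Nat.lt_or_ge n 2 with hn | hn
  · interval_cases n
    · have : ‖(((0 + 5 : ℕ) : ℚ_[3]))⁻¹‖ = 1 := by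
        rw [norm_inv, Padic.norm_eq_zpow_neg_valuation (by norm_num), Padic.valuation_natCast,
          padicValNat.eq_zero_of_not_dvd (by norm_num)]; simp
      rw [this]; norm_num
    · have : ‖(((1 + 5 : ℕ) : ℚ_[3]))⁻¹‖ = 3 := by
        rw [show ((1 + 5 : ℕ) : ℚ_[3]) = 2 * 3 by norm_num, mul_inv, norm_mul, norm_inv, norm_inv,
          show (2 : ℚ_[3]) = ((2 : ℤ) : ℚ_[3]) by norm_cast, norm_intCast_eq_one_of_not_dvd (by decide),
          show (3 : ℚ_[3]) = ((3 : ℕ) : ℚ_[3]) by norm_cast, Padic.norm_p]; norm_num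
      rw [this]; norm_num
  · obtain ⟨k, rfl⟩ : ∃ k, n = k + 2 := ⟨n - 2, by omega⟩
    have hm : ‖(((k + 2 + 5 : ℕ) : ℚ_[3]))⁻¹‖ ≤ ((k + 2 + 5 : ℕ) : ℝ) := padic_norm_inv_natCast_le _
    have hpow : ((k + 2 + 5 : ℕ) : ℝ) ≤ (3 : ℝ) ^ (k + 2) := by
      have := add_seven_le_three_pow' k
      rw [show k + 2 + 5 = k + 7 by ring]; exact_mod_cast this
    exact hm.trans hpow

/-! ### §1 The Iwasawa series to four terms -/

/-- **`L(y) = −t − t²/2 − t³/3 − t⁴/4 + O(‖t‖⁵)`** (`t = 1 − y`, `‖t‖₃ ≤ 3⁻¹`):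
`‖padicLogSeries 3 y + (t + t²/2 + t³/3 + t⁴/4)‖ ≤ ‖t‖⁵` (terms `tᵐ/m`, `m ≥ 5`, have norm
`≤ ‖t‖⁵·‖1/m‖·‖t‖^{m−5} ≤ ‖t‖⁵`). [cite: Iwasawa1972PadicL, §4.4] -/
theorem norm_padicLogSeries_add_quartic_le {y : ℚ_[3]} (ht : ‖1 - y‖ ≤ 1 / 3) :
    ‖padicLogSeries 3 y + ((1 - y) + (1 - y) ^ 2 / 2 + (1 - y) ^ 3 / 3 + (1 - y) ^ 4 / 4)‖ ≤ ‖1 - y‖ ^ 5 := by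
  set t := 1 - y with htdef
  have ht1 : ‖t‖ < 1 := ht.trans_lt (by norm_num)
  have hsum := summable_padicLogSeries_term (p := 3) ht1
  have hsplit := hsum.sum_add_tsum_nat_add 4
  have hfour : ∑ i ∈ Finset.range 4, -(t ^ (i + 1)) / ((i : ℚ_[3]) + 1) = -(t + t ^ 2 / 2 + t ^ 3 / 3 + t ^ 4 / 4) := by
    simp only [Finset.sum_range_succ, Finset.sum_range_zero]
    push_cast; ring
  have hdef : padicLogSeries 3 y = ∑' n : ℕ, -(t ^ (n + 1)) / ((n : ℚ_[3]) + 1) := by rw [padicLogSeries]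
  rw [hdef, ← hsplit, hfour, neg_add_cancel_comm]
  refine IsUltrametricDist.norm_tsum_le_of_forall_le_of_nonneg (by positivity) fun n ↦ ?_
  have he : -(t ^ (n + 4 + 1)) / (((n + 4 : ℕ) : ℚ_[3]) + 1) = -(t ^ (n + 5) * (((n + 5 : ℕ) : ℚ_[3]))⁻¹) := by
    push_cast; ring
  rw [he, norm_neg, norm_mul, norm_pow]
  calc ‖t‖ ^ (n + 5) * ‖(((n + 5 : ℕ) : ℚ_[3]))⁻¹‖ ≤ ‖t‖ ^ (n + 5) * (3 : ℝ) ^ n := by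
        gcongr; exact norm_inv_natCast_add_five_le' n
    _ = ‖t‖ ^ 5 * (‖t‖ ^ n * (3 : ℝ) ^ n) := by ring
    _ ≤ ‖t‖ ^ 5 * ((1 / 3 : ℝ) ^ n * (3 : ℝ) ^ n) := by gcongr
    _ = ‖t‖ ^ 5 := by rw [← mul_pow]; norm_num

/-! ### §2 The quartic is `1`-Lipschitz -/

/-- The quartic `T + T²/2 + T³/3 + T⁴/4` is `1`-Lipschitz on `‖T‖₃ ≤ 3⁻¹`. [folklore] -/
theorem norm_quarticPoly_sub_le {T T0 : ℚ_[3]} (hT : ‖T‖ ≤ 1 / 3) (hT0 : ‖T0‖ ≤ 1 / 3) :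
    ‖(T + T ^ 2 / 2 + T ^ 3 / 3 + T ^ 4 / 4) - (T0 + T0 ^ 2 / 2 + T0 ^ 3 / 3 + T0 ^ 4 / 4)‖ ≤ ‖T - T0‖ := by
  have hid : (T + T ^ 2 / 2 + T ^ 3 / 3 + T ^ 4 / 4) - (T0 + T0 ^ 2 / 2 + T0 ^ 3 / 3 + T0 ^ 4 / 4) =
      (T - T0) * (1 + (2 : ℚ_[3])⁻¹ * (T + T0) + (3 : ℚ_[3])⁻¹ * (T ^ 2 + T * T0 + T0 ^ 2) +
        (4 : ℚ_[3])⁻¹ * (T ^ 3 + T ^ 2 * T0 + T * T0 ^ 2 + T0 ^ 3)) := by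
    have h2 : (2 : ℚ_[3]) ≠ 0 := by norm_num
    have h3 : (3 : ℚ_[3]) ≠ 0 := by norm_num
    have h4 : (4 : ℚ_[3]) ≠ 0 := by norm_num
    field_simp; ring
  rw [hid, norm_mul]
  have hTT : ‖T * T0‖ ≤ 1 / 9 := by
    rw [norm_mul]; calc ‖T‖ * ‖T0‖ ≤ 1 / 3 * (1 / 3) := by gcongr
      _ = 1 / 9 := by norm_num
  have hT2 : ‖T ^ 2‖ ≤ 1 / 9 := by
    rw [norm_pow]; calc ‖T‖ ^ 2 ≤ (1 / 3) ^ 2 := by gcongr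
      _ = 1 / 9 := by norm_num
  have hT02 : ‖T0 ^ 2‖ ≤ 1 / 9 := by
    rw [norm_pow]; calc ‖T0‖ ^ 2 ≤ (1 / 3) ^ 2 := by gcongr
      _ = 1 / 9 := by norm_num
  have hq : ‖T ^ 2 + T * T0 + T0 ^ 2‖ ≤ 1 / 9 :=
    (IsUltrametricDist.norm_add_le_max _ _).trans (max_le ((IsUltrametricDist.norm_add_le_max _ _).trans
      (max_le hT2 hTT)) hT02)
  have hc : ‖T ^ 3 + T ^ 2 * T0 + T * T0 ^ 2 + T0 ^ 3‖ ≤ 1 := by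
    refine (IsUltrametricDist.norm_add_le_max _ _).trans (max_le ?_ ?_)
    · refine (IsUltrametricDist.norm_add_le_max _ _).trans (max_le ?_ ?_)
      · refine (IsUltrametricDist.norm_add_le_max _ _).trans (max_le ?_ ?_)
        · rw [norm_pow]; exact pow_le_one₀ (norm_nonneg _) (hT.trans (by norm_num))
        · rw [norm_mul]; calc ‖T ^ 2‖ * ‖T0‖ ≤ 1 / 9 * (1 / 3) := by gcongr
            _ ≤ 1 := by norm_num
      · rw [norm_mul]; calc ‖T‖ * ‖T0 ^ 2‖ ≤ 1 / 3 * (1 / 9) := by gcongr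
          _ ≤ 1 := by norm_num
    · rw [norm_pow]; exact pow_le_one₀ (norm_nonneg _) (hT0.trans (by norm_num))
  have hbr : ‖1 + (2 : ℚ_[3])⁻¹ * (T + T0) + (3 : ℚ_[3])⁻¹ * (T ^ 2 + T * T0 + T0 ^ 2) +
      (4 : ℚ_[3])⁻¹ * (T ^ 3 + T ^ 2 * T0 + T * T0 ^ 2 + T0 ^ 3)‖ ≤ 1 := by
    refine (IsUltrametricDist.norm_add_le_max _ _).trans (max_le ?_ ?_)
    · refine (IsUltrametricDist.norm_add_le_max _ _).trans (max_le ?_ ?_)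
      · refine (IsUltrametricDist.norm_add_le_max _ _).trans (max_le (by rw [norm_one]) ?_)
        rw [norm_mul, norm_inv_two₁₁, one_mul]
        exact ((IsUltrametricDist.norm_add_le_max _ _).trans (max_le hT hT0)).trans (by norm_num)
      · rw [norm_mul, norm_inv_three₁₁]
        calc 3 * ‖T ^ 2 + T * T0 + T0 ^ 2‖ ≤ 3 * (1 / 9) := by gcongr
          _ ≤ 1 := by norm_num
    · rw [norm_mul, norm_inv_four₁₁, one_mul]; exact hc
  calc ‖T - T0‖ * _ ≤ ‖T - T0‖ * 1 := by gcongr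
    _ = ‖T - T0‖ := mul_one _

/-! ### §3 The Iwasawa logarithm at valuation `2K` modulo `243` -/

/-- **`‖Y − 3^{2K}U‖ ≤ 3^{−2K−5}`, `‖U‖ = 1`, `‖U² − 1‖ ≤ 3⁻¹ ⇒ ‖log₃ Y − ½(V − V²/2 + V³/3 − V⁴/4)‖ ≤ 3⁻⁵`,
`V = U² − 1`** (`t = Y·3^{−2K}`, `‖t − U‖ ≤ 3⁻⁵`; `L(t²) = −T − T²/2 − T³/3 − T⁴/4 + O(‖T‖⁵)`, `T = 1 − t²`; §1
and the `1`-Lipschitz quartic §2). [cite: Iwasawa1972PadicL, §4.4] -/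
theorem norm_padicLog_sub_le_deepO4 {Y U : ℚ_[3]} (K : ℕ) (hU : ‖U‖ = 1) (hU2 : ‖U ^ 2 - 1‖ ≤ 1 / 3)
    (hY : ‖Y - (3 : ℚ_[3]) ^ (2 * K) * U‖ ≤ ‖(3 : ℚ_[3]) ^ (2 * K)‖ / 243) :
    ‖padicLog 3 Y - (2 : ℚ_[3])⁻¹ *
      ((U ^ 2 - 1) - (U ^ 2 - 1) ^ 2 / 2 + (U ^ 2 - 1) ^ 3 / 3 - (U ^ 2 - 1) ^ 4 / 4)‖ ≤ 1 / 243 := by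
  set P : ℚ_[3] := (3 : ℚ_[3]) ^ (2 * K) with hP
  have hPn : ‖P‖ = ((3 : ℝ) ^ (2 * K))⁻¹ := by
    rw [hP, norm_pow, show (3 : ℚ_[3]) = ((3 : ℕ) : ℚ_[3]) by norm_cast, Padic.norm_p]; simp
  have hPpos : 0 < ‖P‖ := by rw [hPn]; positivity
  have hPU : ‖P * U‖ = ‖P‖ := by rw [norm_mul, hU, mul_one]
  have hYn : ‖Y‖ = ‖P‖ := by
    rw [← hPU]; refine Padic.norm_eq_of_norm_sub_lt_right (hY.trans_lt ?_); rw [hPU]; linarith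
  have hY0 : Y ≠ 0 := by intro h; rw [h, norm_zero] at hYn; exact hPpos.ne hYn
  have hv : Y.valuation = ((2 * K : ℕ) : ℤ) := by
    refine valuation_eq_of_norm_eq hY0 ?_
    rw [hYn, hPn, zpow_neg, zpow_natCast]; norm_num
  have hlog : padicLog 3 Y = (2 : ℚ_[3])⁻¹ * padicLogSeries 3 ((Y * (3 : ℚ_[3]) ^ (-((2 * K : ℕ) : ℤ))) ^ 2) := by
    rw [padicLog_of_ne_zero hY0, hv]; push_cast; rw [show ((3 : ℚ_[3]) - 1) = 2 by norm_num]
  rw [hlog]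
  set t : ℚ_[3] := Y * (3 : ℚ_[3]) ^ (-((2 * K : ℕ) : ℤ)) with ht
  have hP0 : P ≠ 0 := norm_pos_iff.mp hPpos
  have hinv : (3 : ℚ_[3]) ^ (-((2 * K : ℕ) : ℤ)) = P⁻¹ := by rw [zpow_neg, zpow_natCast]
  have htu : t - U = (Y - P * U) * P⁻¹ := by rw [ht, hinv]; field_simp
  have htun : ‖t - U‖ ≤ 1 / 243 := by
    rw [htu, norm_mul, norm_inv]
    calc ‖Y - P * U‖ * ‖P‖⁻¹ ≤ ‖P‖ / 243 * ‖P‖⁻¹ := by gcongr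
      _ = 1 / 243 := by field_simp
  have htu1 : ‖t + U‖ ≤ 1 := by
    rw [show t + U = (t - U) + 2 * U by ring]
    refine (IsUltrametricDist.norm_add_le_max _ _).trans (max_le (htun.trans (by norm_num)) ?_)
    rw [norm_mul, hU, mul_one, show (2 : ℚ_[3]) = ((2 : ℤ) : ℚ_[3]) by norm_cast]; exact Padic.norm_int_le_one _
  set T : ℚ_[3] := 1 - t ^ 2 with hT
  set T0 : ℚ_[3] := 1 - U ^ 2 with hT0
  have hTT0 : ‖T - T0‖ ≤ 1 / 243 := by
    rw [show T - T0 = -((t - U) * (t + U)) by rw [hT, hT0]; ring, norm_neg, norm_mul]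
    calc ‖t - U‖ * ‖t + U‖ ≤ 1 / 243 * 1 := by gcongr
      _ = 1 / 243 := mul_one _
  have hT0n : ‖T0‖ ≤ 1 / 3 := by rw [hT0, ← norm_neg, neg_sub]; exact hU2
  have hTn : ‖T‖ ≤ 1 / 3 := by
    rw [show T = (T - T0) + T0 by ring]
    exact (IsUltrametricDist.norm_add_le_max _ _).trans (max_le (hTT0.trans (by norm_num)) hT0n)
  have hL := norm_padicLogSeries_add_quartic_le (y := t ^ 2) (by rw [← hT]; exact hTn)
  rw [← hT] at hL
  have hP4 := norm_quarticPoly_sub_le hTn hT0n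
  have hU' : U ^ 2 - 1 = -T0 := by rw [hT0]; ring
  rw [hU']
  have hsplit : (2 : ℚ_[3])⁻¹ * padicLogSeries 3 (t ^ 2) -
      (2 : ℚ_[3])⁻¹ * (-T0 - (-T0) ^ 2 / 2 + (-T0) ^ 3 / 3 - (-T0) ^ 4 / 4) =
      (2 : ℚ_[3])⁻¹ * ((padicLogSeries 3 (t ^ 2) + (T + T ^ 2 / 2 + T ^ 3 / 3 + T ^ 4 / 4)) -
        ((T + T ^ 2 / 2 + T ^ 3 / 3 + T ^ 4 / 4) - (T0 + T0 ^ 2 / 2 + T0 ^ 3 / 3 + T0 ^ 4 / 4))) := by ring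
  rw [hsplit, norm_mul, norm_inv_two₁₁, one_mul]
  refine (norm_sub_le_max₁₁ _ _).trans (max_le (hL.trans ?_) (hP4.trans hTT0))
  calc ‖T‖ ^ 5 ≤ (1 / 3) ^ 5 := by gcongr
    _ = 1 / 243 := by norm_num

end Summit.BirchSwinnertonDyer.Rank1Residual.X11b.RegMult.KernelCert
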